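import Literature.Topology.FourManifolds.ChartLoops
import Literature.Topology.FourManifolds.BandSumModel
import Mathlib.Analysis.SpecialFunctions.Sqrt
import HarnessLib

/-!
# The inverted picture of a flat strip: inversion, reflection and unbending

Topic `Literature/Topology/FourManifolds`; step V5-2 of the proof programme of the Fox–Milnor
fact `Literature.Topology.FourManifolds.Knot.exists_isConnectedSum_isConcordant` (the second
concordance, charted and straightened along a spanning arc (`LongAnnulus.exists_flat_strip`), is
inverted in a small sphere next to its flat strip, so that its whole moving body lands in a tiny
ball while the strip becomes a static round ring, whose bottom is then unbent into a straight
window: the picture of a small summand ready for the band sum at *all* levels). Everything here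
is proved; no named fact is introduced.

Data: the base point `x₀`, the (horizontal, unit) direction `e` of the strip and the diameter
`a > 0` of the ring. With the vertical `v₃ = (0, 0, 1)` and `ctr = x₀ + a v₃`:

* `invRefl x₀ e a x = ctr + (a² / ‖x - ctr‖²) • ρ₀ (x - ctr)` — the inversion in the sphere of
  radius `a` about `ctr` composed with the reflection `ρ₀` in the vertical plane through `ctr`
  containing the strip (`ρ₀ = (ℝ ∙ nrm e)ᗮ.reflection`, `nrm e = (e₁, -e₀, 0)`); written as
  `T ∘ inv3 ∘ ρ₀ ∘ T⁻¹` with the similarity `T z = ctr + (a/2) z` (`invRefl_eq`), so that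
  `ChartLoops.isChartLoop_inv3_reflection` applies. On the strip line
  `invRefl (x₀ + u e) = x₀ + W u • e + H u • v₃` with `W u = a² u / (a² + u²)`,
  `H u = a u² / (a² + u²)` (`invRefl_line`): the circle of diameter `a` through `ctr` with
  lowest point `x₀`; far points `‖x - x₀‖ ≥ r` go into the ball `B̄(ctr, a²/(r - a))`
  (`dist_invRefl_ctr_le`).
* `Hb a w = a/2 - √(a²/4 - w²)` — the height of the bottom arc over the coordinate `w` along
  `e` (`H u = Hb a (W u)` for `|u| ≤ a`, `H_eq_Hb`); the unbending shear
  `unbend x₀ e a φ x = x - (φ (⟪x - x₀, e⟫) * Hb a ⟪x - x₀, e⟫) • v₃` for a cut-off `φ`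
  supported in `(-a/2, a/2)`: smooth, a shear along `v₃` by a function invariant along `v₃`
  (`ChartLoops.isIsotopic_shear`), straightening the bottom arc where `φ = 1` (`unbend_arc`).

## References

* R. H. Fox, J. W. Milnor, Osaka J. Math. 3 (1966), §1. [FoxMilnor1966]

## Design notes

No named facts, no `sorry`; `𝔼 n` is local notation as in `Knots.lean`.
-/

open scoped Topology ContDiff Real RealInnerProductSpace
open Function Set Metric Filter

noncomputable section

namespace Literature.Topology.FourManifolds

/-- Local notation: `𝔼 n` is the model Euclidean space `EuclideanSpace ℝ (Fin n)`. -/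
local notation "𝔼 " n:arg => EuclideanSpace ℝ (Fin n)

open FoxMilnorModel

namespace InvertedPicture

/-! ### The vertical and the normal of the strip plane -/

/-- The vertical unit vector `(0, 0, 1)` of the chart. [folklore] -/
def v₃ : 𝔼 3 := EuclideanSpace.single 2 1

/-- `‖v₃‖ = 1`. [folklore] -/
@[simp] theorem norm_v₃ : ‖v₃‖ = 1 := by simp [v₃]

/-- Coordinates of `v₃`. [folklore] -/
theorem v₃_apply (i : Fin 3) : v₃ i = if i = 2 then 1 else 0 := by
  simp [v₃]

/-- `⟪x, v₃⟫ = x 2`. [folklore] -/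
theorem inner_v₃_right (x : 𝔼 3) : ⟪x, v₃⟫ = x 2 := by
  simp [v₃, EuclideanSpace.inner_single_right]

/-- `⟪v₃, x⟫ = x 2`. [folklore] -/
theorem inner_v₃_left (x : 𝔼 3) : ⟪v₃, x⟫ = x 2 := by rw [real_inner_comm, inner_v₃_right]

/-- A horizontal vector is orthogonal to `v₃`. [folklore] -/
theorem inner_v₃_of_horizontal {e : 𝔼 3} (he2 : e 2 = 0) : ⟪e, v₃⟫ = 0 := by
  rw [inner_v₃_right, he2]

/-- The same with the arguments swapped. [folklore] -/
theorem inner_v₃_left_of_horizontal {e : 𝔼 3} (he2 : e 2 = 0) : ⟪v₃, e⟫ = 0 := by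
  rw [inner_v₃_left, he2]

/-- The horizontal normal `(e₁, -e₀, 0)` of the vertical plane containing `e`. [folklore] -/
def nrm (e : 𝔼 3) : 𝔼 3 := EuclideanSpace.single 0 (e 1) + EuclideanSpace.single 1 (-(e 0))

/-- Coordinates of `nrm e`. [folklore] -/
theorem nrm_apply (e : 𝔼 3) (i : Fin 3) :
    nrm e i = (if i = 0 then e 1 else 0) + (if i = 1 then -(e 0) else 0) := by
  simp [nrm]

/-- `nrm e ⊥ e`. [folklore] -/
theorem inner_nrm_e (e : 𝔼 3) : ⟪nrm e, e⟫ = 0 := by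
  rw [BandFoliation.inner_eq_three]; simp [nrm_apply]; ring

/-- `nrm e ⊥ v₃`. [folklore] -/
theorem inner_nrm_v₃ (e : 𝔼 3) : ⟪nrm e, v₃⟫ = 0 := by
  rw [BandFoliation.inner_eq_three]; simp [nrm_apply, v₃_apply]

/-- The reflection in the vertical plane containing `e` fixes `e`. [folklore] -/
theorem refl_e (e : 𝔼 3) : (ℝ ∙ nrm e)ᗮ.reflection e = e := by
  rw [reflection_orthogonal_singleton_apply, inner_nrm_e]; simp

/-- The reflection in the vertical plane containing `e` fixes `v₃`. [folklore] -/
theorem refl_v₃ (e : 𝔼 3) : (ℝ ∙ nrm e)ᗮ.reflection v₃ = v₃ := by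
  rw [reflection_orthogonal_singleton_apply, inner_nrm_v₃]; simp

/-- `nrm e ≠ 0` for a horizontal unit vector `e`. [folklore] -/
theorem nrm_ne_zero {e : 𝔼 3} (he : ‖e‖ = 1) (he2 : e 2 = 0) : nrm e ≠ 0 := by
  intro h0
  have h1 : nrm e 0 = 0 := by rw [h0]; rfl
  have h2 : nrm e 1 = 0 := by rw [h0]; rfl
  simp [nrm_apply] at h1 h2
  have : ‖e‖ ^ 2 = 0 := by
    rw [EuclideanSpace.norm_eq, Real.sq_sqrt (by positivity), Fin.sum_univ_three]
    simp [h1, h2, he2]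
  rw [he] at this; norm_num at this

/-! ### The inversion composed with the reflection -/

variable (x₀ e : 𝔼 3) (a : ℝ)

/-- The centre `x₀ + a v₃` of the inversion. [folklore] -/
def ctr : 𝔼 3 := x₀ + a • v₃

/-- **The inversion in the sphere of radius `a` about `ctr`, composed with the reflection in the
vertical plane through `ctr` containing the strip.** [folklore] -/
def invRefl (x : 𝔼 3) : 𝔼 3 :=
  ctr x₀ a + (a ^ 2 / ‖x - ctr x₀ a‖ ^ 2) • (ℝ ∙ nrm e)ᗮ.reflection (x - ctr x₀ a)

/-- **`invRefl` is `T ∘ inv3 ∘ ρ₀ ∘ T⁻¹`** with `T z = ctr + (a/2) • z`. [folklore] -/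
theorem invRefl_eq {a : ℝ} (ha : 0 < a) (x : 𝔼 3) :
    invRefl x₀ e a x = ctr x₀ a + (a / 2) • inv3 ((ℝ ∙ nrm e)ᗮ.reflection ((2 / a) • (x - ctr x₀ a))) := by
  rw [invRefl, inv3_apply, map_smul, norm_smul, LinearIsometryEquiv.norm_map, Real.norm_eq_abs,
    abs_of_pos (by positivity : (0 : ℝ) < 2 / a), smul_smul, smul_smul]
  by_cases hx : ‖x - ctr x₀ a‖ = 0
  · rw [norm_eq_zero.1 hx]; simp
  · congr 1
    field_simp
    ring

/-- **`invRefl` on the strip line**: `x₀ + u e ↦ x₀ + W u • e + H u • v₃`. [folklore] -/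
theorem invRefl_line {e : 𝔼 3} (he : ‖e‖ = 1) (he2 : e 2 = 0) {a : ℝ} (ha : 0 < a) (u : ℝ) :
    invRefl x₀ e a (x₀ + u • e) =
      x₀ + (a ^ 2 * u / (a ^ 2 + u ^ 2)) • e + (a * u ^ 2 / (a ^ 2 + u ^ 2)) • v₃ := by
  have hev : ⟪e, v₃⟫ = 0 := inner_v₃_of_horizontal he2
  have hdiff : x₀ + u • e - ctr x₀ a = u • e - a • v₃ := by rw [ctr]; abel
  have hnorm : ‖u • e - a • v₃‖ ^ 2 = a ^ 2 + u ^ 2 := by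
    rw [@norm_sub_sq_real, norm_smul, norm_smul, he, norm_v₃, inner_smul_left, inner_smul_right, hev]
    simp [Real.norm_eq_abs, sq_abs]; ring
  have hD : a ^ 2 + u ^ 2 ≠ 0 := by positivity
  rw [invRefl, hdiff, hnorm, map_sub, map_smul, map_smul, refl_e, refl_v₃, ctr, smul_sub, smul_smul, smul_smul]
  have h1 : a ^ 2 / (a ^ 2 + u ^ 2) * a = a - a * u ^ 2 / (a ^ 2 + u ^ 2) := by field_simp; ring
  rw [h1, sub_smul, show a ^ 2 / (a ^ 2 + u ^ 2) * u = a ^ 2 * u / (a ^ 2 + u ^ 2) by ring]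
  abel

/-- The distance of `invRefl x` from the centre is `a² / ‖x - ctr‖`. [folklore] -/
theorem dist_invRefl_ctr {x : 𝔼 3} (hx : x ≠ ctr x₀ a) :
    dist (invRefl x₀ e a x) (ctr x₀ a) = a ^ 2 / ‖x - ctr x₀ a‖ := by
  have hn : ‖x - ctr x₀ a‖ ≠ 0 := norm_ne_zero_iff.2 (sub_ne_zero.2 hx)
  rw [invRefl, dist_eq_norm, add_sub_cancel_left, norm_smul, LinearIsometryEquiv.norm_map, Real.norm_eq_abs,
    abs_of_nonneg (by positivity)]
  field_simp

/-- **Far points go into the small ball**: `‖x - x₀‖ ≥ r > a ≥ 0` implies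
`dist (invRefl x) ctr ≤ a² / (r - a)`. [folklore] -/
theorem dist_invRefl_ctr_le {a r : ℝ} (ha : 0 ≤ a) (har : a < r) {x : 𝔼 3} (hx : r ≤ ‖x - x₀‖) :
    dist (invRefl x₀ e a x) (ctr x₀ a) ≤ a ^ 2 / (r - a) := by
  have hxc : r - a ≤ ‖x - ctr x₀ a‖ := by
    have : ‖x - x₀‖ ≤ ‖x - ctr x₀ a‖ + ‖ctr x₀ a - x₀‖ := norm_sub_le_norm_sub_add_norm_sub _ _ _
    rw [show ctr x₀ a - x₀ = a • v₃ by rw [ctr]; abel, norm_smul, norm_v₃, mul_one, Real.norm_eq_abs,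
      abs_of_nonneg ha] at this
    linarith
  have hpos : 0 < r - a := by linarith
  have hne : x ≠ ctr x₀ a := by
    intro h; rw [h, sub_self, norm_zero] at hxc; linarith
  rw [dist_invRefl_ctr x₀ e a hne]
  exact div_le_div_of_nonneg_left (by positivity) hpos hxc

/-! ### The bottom arc as a graph, and the unbending shear -/

/-- The coordinate of the ring along `e`: `W u = a² u / (a² + u²)`. [folklore] -/
def W (u : ℝ) : ℝ := a ^ 2 * u / (a ^ 2 + u ^ 2)

/-- The height of the ring: `H u = a u² / (a² + u²)`. [folklore] -/
def H (u : ℝ) : ℝ := a * u ^ 2 / (a ^ 2 + u ^ 2)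

/-- **The height of the bottom arc over the coordinate `w`**: `a/2 - √(a²/4 - w²)`. [folklore] -/
def Hb (w : ℝ) : ℝ := a / 2 - Real.sqrt (a ^ 2 / 4 - w ^ 2)

/-- `W u ^ 2 ≤ a²/4`, with the defect `a²/4 - W² = (a (a² - u²) / (2 (a² + u²)))²`. [folklore] -/
theorem sq_sub_W_sq {a : ℝ} (ha : 0 < a) (u : ℝ) :
    a ^ 2 / 4 - W a u ^ 2 = (a * (a ^ 2 - u ^ 2) / (2 * (a ^ 2 + u ^ 2))) ^ 2 := by
  have hD : a ^ 2 + u ^ 2 ≠ 0 := by positivity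
  rw [W]; field_simp; ring

/-- **The ring is the graph of `Hb` over its bottom arc**: `H u = Hb (W u)` for `|u| ≤ a`.
[folklore] -/
theorem H_eq_Hb {a : ℝ} (ha : 0 < a) {u : ℝ} (hu : |u| ≤ a) : H a u = Hb a (W a u) := by
  have hD : 0 < a ^ 2 + u ^ 2 := by positivity
  have hnn : 0 ≤ a * (a ^ 2 - u ^ 2) / (2 * (a ^ 2 + u ^ 2)) := by
    apply div_nonneg (mul_nonneg ha.le ?_) (by positivity)
    nlinarith [abs_nonneg u, sq_abs u]
  rw [Hb, sq_sub_W_sq ha, Real.sqrt_sq hnn, H]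
  field_simp
  ring

/-- `|W u| < a/2` unless `|u| = a`; in particular `|W u| < a/2` for `|u| < a`. [folklore] -/
theorem abs_W_lt {a : ℝ} (ha : 0 < a) {u : ℝ} (hu : |u| < a) : |W a u| < a / 2 := by
  have hD : 0 < a ^ 2 + u ^ 2 := by positivity
  rw [W, abs_div, abs_of_pos hD, div_lt_iff₀ hD, abs_mul, abs_of_pos (by positivity : (0 : ℝ) < a ^ 2)]
  have hu2 : u ^ 2 < a ^ 2 := by
    have := abs_nonneg u
    calc u ^ 2 = |u| ^ 2 := (sq_abs u).symm
      _ < a ^ 2 := by exact pow_lt_pow_left₀ hu this two_ne_zero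
  nlinarith [abs_nonneg u, sq_abs u, sq_nonneg (a - |u|)]

/-- `|W u| ≤ |u|`. [folklore] -/
theorem abs_W_le (u : ℝ) (ha : 0 < a) : |W a u| ≤ |u| := by
  have hD : 0 < a ^ 2 + u ^ 2 := by positivity
  rw [W, abs_div, abs_of_pos hD, div_le_iff₀ hD, abs_mul, abs_of_pos (by positivity : (0 : ℝ) < a ^ 2)]
  nlinarith [abs_nonneg u, sq_abs u]

/-- `Hb` is `C^∞` on `(-a/2, a/2)` points. [folklore] -/
theorem contDiffAt_Hb {a w : ℝ} (hw : |w| < a / 2) : ContDiffAt ℝ ∞ (Hb a) w := by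
  have hpos : 0 < a ^ 2 / 4 - w ^ 2 := by
    have : w ^ 2 < (a / 2) ^ 2 := by
      rw [← sq_abs]; exact pow_lt_pow_left₀ hw (abs_nonneg w) two_ne_zero
    nlinarith
  exact contDiffAt_const.sub ((contDiffAt_const.sub (contDiffAt_id.pow 2)).sqrt hpos.ne')

/-- `0 ≤ Hb a w ≤ a/2` for `|w| ≤ a/2` (`a ≥ 0`). [folklore] -/
theorem Hb_mem {a w : ℝ} (ha : 0 ≤ a) (hw : |w| ≤ a / 2) : Hb a w ∈ Icc 0 (a / 2) := by
  have h1 : 0 ≤ a ^ 2 / 4 - w ^ 2 := by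
    have : w ^ 2 ≤ (a / 2) ^ 2 := by rw [← sq_abs]; exact pow_le_pow_left₀ (abs_nonneg w) hw 2
    nlinarith
  have h2 : Real.sqrt (a ^ 2 / 4 - w ^ 2) ≤ a / 2 := by
    rw [Real.sqrt_le_left (by positivity)]; nlinarith [sq_nonneg w]
  exact ⟨by rw [Hb]; linarith, by rw [Hb]; linarith [Real.sqrt_nonneg (a ^ 2 / 4 - w ^ 2)]⟩

/-- `Hb` is monotone in `|w|`: `Hb a w ≤ Hb a w'` when `|w| ≤ |w'|`. [folklore] -/
theorem Hb_mono (a : ℝ) {w w' : ℝ} (hww : |w| ≤ |w'|) : Hb a w ≤ Hb a w' := by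
  rw [Hb, Hb]
  have : Real.sqrt (a ^ 2 / 4 - w' ^ 2) ≤ Real.sqrt (a ^ 2 / 4 - w ^ 2) := by
    apply Real.sqrt_le_sqrt
    have : w ^ 2 ≤ w' ^ 2 := by rw [← sq_abs w, ← sq_abs w']; exact pow_le_pow_left₀ (abs_nonneg _) hww 2
    linarith
  linarith

variable (φ : ℝ → ℝ)

/-- **The unbending shear** `x ↦ x - (φ (⟪x - x₀, e⟫) * Hb ⟪x - x₀, e⟫) • v₃`. [folklore] -/
def unbend (x : 𝔼 3) : 𝔼 3 := x - (φ (⟪x - x₀, e⟫) * Hb a ⟪x - x₀, e⟫) • v₃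

/-- The shear function `x ↦ -(φ w * Hb w)`, `w = ⟪x - x₀, e⟫`. [folklore] -/
def shearFn (x : 𝔼 3) : ℝ := -(φ (⟪x - x₀, e⟫) * Hb a ⟪x - x₀, e⟫)

/-- `unbend x = x + shearFn x • v₃`. [folklore] -/
theorem unbend_eq (x : 𝔼 3) : unbend x₀ e a φ x = x + shearFn x₀ e a φ x • v₃ := by
  rw [unbend, shearFn, neg_smul, sub_eq_add_neg]

variable {x₀ e a φ}

/-- The shear function is invariant along `v₃` (for horizontal `e`). [folklore] -/
theorem shearFn_add_smul (he2 : e 2 = 0) (x : 𝔼 3) (s : ℝ) :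
    shearFn x₀ e a φ (x + s • v₃) = shearFn x₀ e a φ x := by
  have : ⟪x + s • v₃ - x₀, e⟫ = ⟪x - x₀, e⟫ := by
    rw [show x + s • v₃ - x₀ = (x - x₀) + s • v₃ by abel, inner_add_left, inner_smul_left,
      inner_v₃_left_of_horizontal he2, mul_zero, add_zero]
  rw [shearFn, shearFn, this]

/-- **The cut-off product `φ · Hb` is `C^∞`** when `φ` is `C^∞` and vanishes off
`[-w₂, w₂]`, `w₂ < a/2`. [folklore] -/
theorem contDiff_mul_Hb (hφ : ContDiff ℝ ∞ φ) {w₂ : ℝ} (hw₂ : w₂ < a / 2)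
    (hsupp : ∀ w, w₂ ≤ |w| → φ w = 0) : ContDiff ℝ ∞ fun w ↦ φ w * Hb a w := by
  rw [contDiff_iff_contDiffAt]
  intro w
  by_cases hw : |w| < a / 2
  · exact hφ.contDiffAt.mul (contDiffAt_Hb hw)
  · have hfar : w₂ < |w| := lt_of_lt_of_le hw₂ (not_lt.1 hw)
    refine (contDiffAt_const (c := (0 : ℝ))).congr_of_eventuallyEq ?_
    have hO : IsOpen {w' : ℝ | w₂ < |w'|} := isOpen_lt continuous_const continuous_abs
    filter_upwards [hO.mem_nhds hfar] with w' hw'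
    simp [hsupp w' (le_of_lt hw')]

/-- The shear function is `C^∞`. [folklore] -/
theorem contDiff_shearFn (hφ : ContDiff ℝ ∞ φ) {w₂ : ℝ} (hw₂ : w₂ < a / 2)
    (hsupp : ∀ w, w₂ ≤ |w| → φ w = 0) : ContDiff ℝ ∞ (shearFn x₀ e a φ) :=
  ((contDiff_mul_Hb hφ hw₂ hsupp).comp ((contDiff_id.sub contDiff_const).inner ℝ contDiff_const)).neg

/-- `unbend` is `C^∞`. [folklore] -/
theorem contDiff_unbend (hφ : ContDiff ℝ ∞ φ) {w₂ : ℝ} (hw₂ : w₂ < a / 2)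
    (hsupp : ∀ w, w₂ ≤ |w| → φ w = 0) : ContDiff ℝ ∞ (unbend x₀ e a φ) := by
  have : unbend x₀ e a φ = fun x ↦ x + shearFn x₀ e a φ x • v₃ := funext (unbend_eq x₀ e a φ)
  rw [this]
  exact contDiff_id.add ((contDiff_shearFn hφ hw₂ hsupp).smul contDiff_const)

/-- `unbend` is injective (a shear along `v₃`). [folklore] -/
theorem unbend_injective (he2 : e 2 = 0) : Injective (unbend x₀ e a φ) := by
  intro x y hxy
  rw [unbend_eq, unbend_eq] at hxy
  have hs : y = x + (shearFn x₀ e a φ x - shearFn x₀ e a φ y) • v₃ := by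
    rw [sub_smul, ← add_sub_assoc, hxy, add_sub_cancel_right]
  have hg : shearFn x₀ e a φ y = shearFn x₀ e a φ x := by rw [hs, shearFn_add_smul he2]
  rw [hg] at hxy
  exact add_right_cancel hxy

/-- **The unbending straightens the bottom arc where `φ = 1`**:
`unbend (x₀ + W u • e + H u • v₃) = x₀ + W u • e` for `|u| ≤ a`, `φ (W u) = 1`. [folklore] -/
theorem unbend_arc (he : ‖e‖ = 1) (he2 : e 2 = 0) (ha : 0 < a) {u : ℝ} (hu : |u| ≤ a)
    (hφ1 : φ (W a u) = 1) : unbend x₀ e a φ (x₀ + W a u • e + H a u • v₃) = x₀ + W a u • e := by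
  have hw : ⟪x₀ + W a u • e + H a u • v₃ - x₀, e⟫ = W a u := by
    rw [show x₀ + W a u • e + H a u • v₃ - x₀ = W a u • e + H a u • v₃ by abel, inner_add_left, inner_smul_left,
      inner_smul_left, real_inner_self_eq_norm_sq, he, real_inner_comm, inner_v₃_of_horizontal he2]
    simp
  rw [unbend, hw, hφ1, one_mul, ← H_eq_Hb ha hu]
  abel

/-- In general the unbending lowers the height by `φ w * Hb w`, `w = ⟪x - x₀, e⟫`, and keeps the
horizontal coordinates. [folklore] -/
theorem unbend_apply_two (x : 𝔼 3) : unbend x₀ e a φ x 2 = x 2 - φ (⟪x - x₀, e⟫) * Hb a ⟪x - x₀, e⟫ := by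
  simp [unbend, v₃_apply]

/-- The unbending keeps the coordinate along `e`. [folklore] -/
theorem inner_unbend_sub (he2 : e 2 = 0) (x : 𝔼 3) : ⟪unbend x₀ e a φ x - x₀, e⟫ = ⟪x - x₀, e⟫ := by
  rw [unbend, show x - (φ (⟪x - x₀, e⟫) * Hb a ⟪x - x₀, e⟫) • v₃ - x₀ = (x - x₀) - (φ (⟪x - x₀, e⟫) * Hb a ⟪x - x₀, e⟫) • v₃
    by abel, inner_sub_left, inner_smul_left, inner_v₃_left_of_horizontal he2, mul_zero, sub_zero]

/-! ### The ring coordinate `W`: bounds and monotonicity -/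

/-- `|W u| ≤ a/2` (`a > 0`). [folklore] -/
theorem abs_W_le_half {a : ℝ} (ha : 0 < a) (u : ℝ) : |W a u| ≤ a / 2 := by
  have hD : 0 < a ^ 2 + u ^ 2 := by positivity
  rw [W, abs_div, abs_of_pos hD, div_le_iff₀ hD, abs_mul, abs_of_pos (by positivity : (0 : ℝ) < a ^ 2)]
  nlinarith [abs_nonneg u, sq_abs u, sq_nonneg (a - |u|), ha]

/-- The derivative of `W`: `W' u = a² (a² - u²) / (a² + u²)²`. [folklore] -/
theorem hasDerivAt_W {a : ℝ} (ha : 0 < a) (u : ℝ) :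
    HasDerivAt (W a) (a ^ 2 * (a ^ 2 - u ^ 2) / (a ^ 2 + u ^ 2) ^ 2) u := by
  have hD : a ^ 2 + u ^ 2 ≠ 0 := by positivity
  have h1 : HasDerivAt (fun u ↦ a ^ 2 * u) (a ^ 2 * 1) u := (hasDerivAt_id u).const_mul _
  have h2 : HasDerivAt (fun u ↦ a ^ 2 + u ^ 2) (0 + 2 * u ^ 1 * 1) u :=
    (hasDerivAt_const u _).add ((hasDerivAt_id u).pow 2)
  have h := h1.div h2 hD
  have hfun : (fun u ↦ a ^ 2 * u) / (fun u ↦ a ^ 2 + u ^ 2) = W a := by funext u; simp [W]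
  have heq : (a ^ 2 * 1 * (a ^ 2 + u ^ 2) - a ^ 2 * u * (0 + 2 * u ^ 1 * 1)) / (a ^ 2 + u ^ 2) ^ 2 =
      a ^ 2 * (a ^ 2 - u ^ 2) / (a ^ 2 + u ^ 2) ^ 2 := by ring
  rw [hfun, heq] at h
  exact h

/-- `W` is `C^∞`. [folklore] -/
theorem contDiff_W {a : ℝ} (ha : 0 < a) : ContDiff ℝ ∞ (W a) := by
  have : W a = fun u ↦ a ^ 2 * u / (a ^ 2 + u ^ 2) := rfl
  rw [this]
  exact (contDiff_const.mul contDiff_id).div (contDiff_const.add (contDiff_id.pow 2)) fun u ↦ by positivity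

/-- `W' > 0` on `(-a, a)`. [folklore] -/
theorem deriv_W_pos {a : ℝ} (ha : 0 < a) {u : ℝ} (hu : |u| < a) : 0 < deriv (W a) u := by
  rw [(hasDerivAt_W ha u).deriv]
  have hu2 : u ^ 2 < a ^ 2 := by
    rw [← sq_abs]; exact pow_lt_pow_left₀ hu (abs_nonneg u) two_ne_zero
  have : 0 < a ^ 2 - u ^ 2 := by linarith
  positivity

/-- `W` is odd. [folklore] -/
theorem W_neg (a u : ℝ) : W a (-u) = -W a u := by rw [W, W]; ring

/-- `W 0 = 0`. [folklore] -/
@[simp] theorem W_zero (a : ℝ) : W a 0 = 0 := by simp [W]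

/-- `H u ≥ 0` (`a ≥ 0`). [folklore] -/
theorem H_nonneg {a : ℝ} (ha : 0 ≤ a) (u : ℝ) : 0 ≤ H a u := by
  rw [H]; positivity

/-- `H u ≥ a/2` for `|u| ≥ a > 0`. [folklore] -/
theorem half_le_H {a : ℝ} (ha : 0 < a) {u : ℝ} (hu : a ≤ |u|) : a / 2 ≤ H a u := by
  have hD : 0 < a ^ 2 + u ^ 2 := by positivity
  rw [H, le_div_iff₀ hD]
  have hu2 : a ^ 2 ≤ u ^ 2 := by have := pow_le_pow_left₀ ha.le hu 2; rwa [sq_abs] at this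
  nlinarith

/-- `H u ≤ a` (`a ≥ 0`). [folklore] -/
theorem H_le {a : ℝ} (ha : 0 ≤ a) (u : ℝ) : H a u ≤ a := by
  have hD : 0 < a ^ 2 + u ^ 2 ∨ (a = 0 ∧ u = 0) := by
    by_cases h : a ^ 2 + u ^ 2 = 0
    · right; constructor <;> nlinarith [sq_nonneg a, sq_nonneg u]
    · left; positivity
  rcases hD with hD | ⟨rfl, rfl⟩
  · rw [H, div_le_iff₀ hD]; nlinarith [sq_nonneg a]
  · simp [H]

/-- `Hb (a/4) ≤ a/8` (`a ≥ 0`). [folklore] -/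
theorem Hb_quarter_le {a : ℝ} (ha : 0 ≤ a) : Hb a (a / 4) ≤ a / 8 := by
  rw [Hb]
  have : 3 * a / 8 ≤ Real.sqrt (a ^ 2 / 4 - (a / 4) ^ 2) :=
    calc 3 * a / 8 = Real.sqrt ((3 * a / 8) ^ 2) := (Real.sqrt_sq (by positivity)).symm
      _ ≤ Real.sqrt (a ^ 2 / 4 - (a / 4) ^ 2) := Real.sqrt_le_sqrt (by nlinarith [sq_nonneg a])
  linarith

/-- `Hb 0 = 0` hence `Hb a w ≥ 0`... precisely: `0 ≤ Hb a w` whenever the radicand is at most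
`a²/4`, i.e. always (`√` of a smaller number). [folklore] -/
theorem Hb_nonneg {a : ℝ} (ha : 0 ≤ a) (w : ℝ) : 0 ≤ Hb a w := by
  rw [Hb, sub_nonneg, Real.sqrt_le_left (by positivity)]
  nlinarith [sq_nonneg w]

/-- `Hb a w ≤ a/2`. [folklore] -/
theorem Hb_le_half (a w : ℝ) : Hb a w ≤ a / 2 := by
  rw [Hb]; linarith [Real.sqrt_nonneg (a ^ 2 / 4 - w ^ 2)]

/-! ### The composite map `Ψ = unbend ∘ invRefl` -/

variable (x₀ e a φ)

/-- **The map of the inverted picture**: inversion-with-reflection followed by the unbending. [folklore] -/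
def Ψ (x : 𝔼 3) : 𝔼 3 := unbend x₀ e a φ (invRefl x₀ e a x)

variable {x₀ e a φ}

/-- **`Ψ` on the strip line**: `Ψ (x₀ + u e) = x₀ + W u • e + (H u - φ (W u) Hb (W u)) • v₃`. [folklore] -/
theorem Ψ_line (he : ‖e‖ = 1) (he2 : e 2 = 0) (ha : 0 < a) (u : ℝ) :
    Ψ x₀ e a φ (x₀ + u • e) = x₀ + W a u • e + (H a u - φ (W a u) * Hb a (W a u)) • v₃ := by
  rw [Ψ, invRefl_line x₀ he he2 ha, unbend]
  have hw : ⟪x₀ + (a ^ 2 * u / (a ^ 2 + u ^ 2)) • e + (a * u ^ 2 / (a ^ 2 + u ^ 2)) • v₃ - x₀, e⟫ = W a u := by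
    rw [show x₀ + (a ^ 2 * u / (a ^ 2 + u ^ 2)) • e + (a * u ^ 2 / (a ^ 2 + u ^ 2)) • v₃ - x₀ =
        (a ^ 2 * u / (a ^ 2 + u ^ 2)) • e + (a * u ^ 2 / (a ^ 2 + u ^ 2)) • v₃ by abel,
      inner_add_left, inner_smul_left, inner_smul_left, real_inner_self_eq_norm_sq, he,
      inner_v₃_left_of_horizontal he2, W]
    simp
  rw [hw, sub_smul, show a ^ 2 * u / (a ^ 2 + u ^ 2) = W a u from rfl, show a * u ^ 2 / (a ^ 2 + u ^ 2) = H a u from rfl]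
  abel

/-- **The window is straight**: `Ψ (x₀ + u e) = x₀ + W u • e` for `|u| ≤ a` with `φ (W u) = 1`. [folklore] -/
theorem Ψ_window (he : ‖e‖ = 1) (he2 : e 2 = 0) (ha : 0 < a) {u : ℝ} (hu : |u| ≤ a) (hφ1 : φ (W a u) = 1) :
    Ψ x₀ e a φ (x₀ + u • e) = x₀ + W a u • e := by
  rw [Ψ_line he he2 ha, hφ1, one_mul, H_eq_Hb ha hu, sub_self, zero_smul, add_zero]

/-- The coordinate of `Ψ x` along `e`, relative to `x₀`, is that of `invRefl x`. [folklore] -/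
theorem inner_Ψ_sub (he2 : e 2 = 0) (x : 𝔼 3) : ⟪Ψ x₀ e a φ x - x₀, e⟫ = ⟪invRefl x₀ e a x - x₀, e⟫ :=
  inner_unbend_sub he2 _

/-- The height of `Ψ x` above `x₀`. [folklore] -/
theorem Ψ_height (x : 𝔼 3) :
    Ψ x₀ e a φ x 2 - x₀ 2 = (invRefl x₀ e a x 2 - x₀ 2) -
      φ (⟪invRefl x₀ e a x - x₀, e⟫) * Hb a ⟪invRefl x₀ e a x - x₀, e⟫ := by
  rw [Ψ, unbend_apply_two]; ring

/-- **Heights on the line are nonnegative**: `(Ψ (x₀ + u e)) 2 ≥ x₀ 2` when `φ ≤ 1`. [folklore] -/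
theorem height_line_nonneg (he : ‖e‖ = 1) (he2 : e 2 = 0) (ha : 0 < a)
    (hφ1 : ∀ w, φ w ≤ 1) (u : ℝ) : x₀ 2 ≤ Ψ x₀ e a φ (x₀ + u • e) 2 := by
  rw [Ψ_line he he2 ha]
  simp only [PiLp.add_apply, PiLp.smul_apply, smul_eq_mul, he2, mul_zero, add_zero, v₃_apply, if_true, mul_one]
  have hHb0 := Hb_nonneg ha.le (W a u)
  have hHbh := Hb_le_half a (W a u)
  rcases le_or_gt |u| a with hu | hu
  · rw [H_eq_Hb ha hu]; nlinarith [hφ1 (W a u)]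
  · have := half_le_H ha hu.le; nlinarith [hφ1 (W a u)]

/-- **Heights on the upper part of the ring**: for `|u| ≥ a`, `(Ψ (x₀ + u e)) 2 ≥ x₀ 2 + a/2 - Hb a w₂`
when `φ ≤ 1` vanishes off `(-w₂, w₂)`, `0 ≤ w₂`. [folklore] -/
theorem height_line_upper (he : ‖e‖ = 1) (he2 : e 2 = 0) (ha : 0 < a)
    (hφ1 : ∀ w, φ w ≤ 1) {w₂ : ℝ} (hw₂ : 0 ≤ w₂) (hsupp : ∀ w, w₂ ≤ |w| → φ w = 0) {u : ℝ} (hu : a ≤ |u|) :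
    x₀ 2 + a / 2 - Hb a w₂ ≤ Ψ x₀ e a φ (x₀ + u • e) 2 := by
  rw [Ψ_line he he2 ha]
  simp only [PiLp.add_apply, PiLp.smul_apply, smul_eq_mul, he2, mul_zero, add_zero, v₃_apply, if_true, mul_one]
  have hH := half_le_H ha hu
  have hterm : φ (W a u) * Hb a (W a u) ≤ Hb a w₂ := by
    rcases le_or_gt w₂ |W a u| with h1 | h1
    · rw [hsupp _ h1, zero_mul]; exact Hb_nonneg ha.le _
    · have hmono : Hb a (W a u) ≤ Hb a w₂ := Hb_mono a (by rw [abs_of_nonneg hw₂]; exact h1.le)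
      nlinarith [hφ1 (W a u), Hb_nonneg ha.le (W a u)]
  linarith

/-- Coordinates of `invRefl x` relative to `x₀` and to `ctr` agree in the horizontal directions
`e` and `nrm e`. [folklore] -/
theorem inner_invRefl_sub_x₀ (he2 : e 2 = 0) (x : 𝔼 3) :
    ⟪invRefl x₀ e a x - x₀, e⟫ = ⟪invRefl x₀ e a x - ctr x₀ a, e⟫ := by
  rw [show invRefl x₀ e a x - x₀ = (invRefl x₀ e a x - ctr x₀ a) + a • v₃ by rw [ctr]; abel, inner_add_left,
    inner_smul_left, inner_v₃_left_of_horizontal he2, mul_zero, add_zero]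

/-- **Far points: horizontal coordinate.** `‖x - x₀‖ ≥ r > a ≥ 0` gives
`|⟪Ψ x - x₀, e⟫| ≤ a²/(r - a)` (`‖e‖ = 1`, `e` horizontal). [folklore] -/
theorem abs_inner_Ψ_far (he : ‖e‖ = 1) (he2 : e 2 = 0) {r : ℝ} (ha : 0 ≤ a) (har : a < r) {x : 𝔼 3}
    (hx : r ≤ ‖x - x₀‖) : |⟪Ψ x₀ e a φ x - x₀, e⟫| ≤ a ^ 2 / (r - a) := by
  rw [inner_Ψ_sub he2, inner_invRefl_sub_x₀ he2]
  refine (abs_real_inner_le_norm _ _).trans ?_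
  rw [he, mul_one, ← dist_eq_norm]
  exact dist_invRefl_ctr_le x₀ e ha har hx

/-- **Far points: height.** `‖x - x₀‖ ≥ r > a ≥ 0`, `ρ := a²/(r - a)`, `φ ≤ 1`: the height of
`Ψ x` above `x₀` is at least `a - ρ - Hb a ρ`. [folklore] -/
theorem height_far (he : ‖e‖ = 1) (he2 : e 2 = 0) {r : ℝ} (ha : 0 ≤ a) (har : a < r)
    (hφ1 : ∀ w, φ w ≤ 1) {x : 𝔼 3} (hx : r ≤ ‖x - x₀‖) :
    x₀ 2 + a - a ^ 2 / (r - a) - Hb a (a ^ 2 / (r - a)) ≤ Ψ x₀ e a φ x 2 := by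
  set y := invRefl x₀ e a x with hy
  have hdist : dist y (ctr x₀ a) ≤ a ^ 2 / (r - a) := dist_invRefl_ctr_le x₀ e ha har hx
  -- height of `y`
  have hy2 : x₀ 2 + a - a ^ 2 / (r - a) ≤ y 2 := by
    have h1 : |(y - ctr x₀ a) 2| ≤ ‖y - ctr x₀ a‖ := by
      have := PiLp.norm_apply_le (y - ctr x₀ a) 2
      rwa [Real.norm_eq_abs] at this
    rw [← dist_eq_norm] at h1
    have h2 : (y - ctr x₀ a) 2 = y 2 - x₀ 2 - a := by
      simp [ctr, v₃_apply]; ring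
    rw [h2] at h1
    have := (abs_le.1 (h1.trans hdist)).1
    linarith
  -- the unbending lowers by at most `Hb ρ`
  have hw : |⟪y - x₀, e⟫| ≤ a ^ 2 / (r - a) := by
    rw [hy, inner_invRefl_sub_x₀ he2]
    refine (abs_real_inner_le_norm _ _).trans ?_
    rw [he, mul_one, ← dist_eq_norm]; exact hdist
  have hterm : φ (⟪y - x₀, e⟫) * Hb a ⟪y - x₀, e⟫ ≤ Hb a (a ^ 2 / (r - a)) := by
    have hmono : Hb a ⟪y - x₀, e⟫ ≤ Hb a (a ^ 2 / (r - a)) :=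
      Hb_mono a (by rwa [abs_of_nonneg (by positivity : (0 : ℝ) ≤ a ^ 2 / (r - a))])
    nlinarith [hφ1 ⟪y - x₀, e⟫, Hb_nonneg ha ⟪y - x₀, e⟫]
  have := Ψ_height (x₀ := x₀) (e := e) (a := a) (φ := φ) x
  rw [← hy] at this
  linarith

/-- **Far points stay near the centre**: `dist (Ψ x) ctr ≤ ρ + Hb a ρ`, `ρ = a²/(r - a)`. [folklore] -/
theorem dist_Ψ_ctr_far (he : ‖e‖ = 1) (he2 : e 2 = 0) {r : ℝ} (ha : 0 ≤ a) (har : a < r)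
    (hφ0 : ∀ w, 0 ≤ φ w) (hφ1 : ∀ w, φ w ≤ 1) {x : 𝔼 3} (hx : r ≤ ‖x - x₀‖) :
    dist (Ψ x₀ e a φ x) (ctr x₀ a) ≤ a ^ 2 / (r - a) + Hb a (a ^ 2 / (r - a)) := by
  set y := invRefl x₀ e a x with hy
  have hdist : dist y (ctr x₀ a) ≤ a ^ 2 / (r - a) := dist_invRefl_ctr_le x₀ e ha har hx
  have hw : |⟪y - x₀, e⟫| ≤ a ^ 2 / (r - a) := by
    rw [hy, inner_invRefl_sub_x₀ he2]
    refine (abs_real_inner_le_norm _ _).trans ?_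
    rw [he, mul_one, ← dist_eq_norm]; exact hdist
  have hterm : |φ (⟪y - x₀, e⟫) * Hb a ⟪y - x₀, e⟫| ≤ Hb a (a ^ 2 / (r - a)) := by
    have hmono : Hb a ⟪y - x₀, e⟫ ≤ Hb a (a ^ 2 / (r - a)) :=
      Hb_mono a (by rwa [abs_of_nonneg (by positivity : (0 : ℝ) ≤ a ^ 2 / (r - a))])
    rw [abs_of_nonneg (mul_nonneg (hφ0 _) (Hb_nonneg ha _))]
    nlinarith [hφ0 ⟪y - x₀, e⟫, hφ1 ⟪y - x₀, e⟫, Hb_nonneg ha ⟪y - x₀, e⟫]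
  have hΨ : Ψ x₀ e a φ x = y - (φ (⟪y - x₀, e⟫) * Hb a ⟪y - x₀, e⟫) • v₃ := rfl
  calc dist (Ψ x₀ e a φ x) (ctr x₀ a) ≤ dist (Ψ x₀ e a φ x) y + dist y (ctr x₀ a) := dist_triangle _ _ _
    _ ≤ Hb a (a ^ 2 / (r - a)) + a ^ 2 / (r - a) := by
        gcongr
        rw [hΨ, dist_eq_norm, sub_sub_cancel_left, norm_neg, norm_smul, norm_v₃, mul_one, Real.norm_eq_abs]
        exact hterm
    _ = _ := add_comm _ _

/-! ### `invRefl` is an involution, smooth and immersive off the centre -/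

/-- `invRefl` fixes the centre (by the convention `x / 0 = 0`). [folklore] -/
theorem invRefl_ctr : invRefl x₀ e a (ctr x₀ a) = ctr x₀ a := by simp [invRefl]

/-- `invRefl x ≠ ctr` for `x ≠ ctr` (`a ≠ 0`). [folklore] -/
theorem invRefl_ne_ctr (ha : a ≠ 0) {x : 𝔼 3} (hx : x ≠ ctr x₀ a) : invRefl x₀ e a x ≠ ctr x₀ a := by
  intro h
  have := dist_invRefl_ctr x₀ e a hx
  rw [h, dist_self] at this
  have hn : 0 < ‖x - ctr x₀ a‖ := norm_pos_iff.2 (sub_ne_zero.2 hx)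
  have : a ^ 2 / ‖x - ctr x₀ a‖ = 0 := this.symm
  rw [div_eq_zero_iff] at this
  rcases this with h1 | h1
  · exact ha (pow_eq_zero_iff two_ne_zero |>.1 h1)
  · exact hn.ne' h1

/-- **`invRefl` is an involution.** [folklore] -/
theorem invRefl_invRefl (ha : a ≠ 0) (x : 𝔼 3) : invRefl x₀ e a (invRefl x₀ e a x) = x := by
  by_cases hx : x = ctr x₀ a
  · rw [hx, invRefl_ctr, invRefl_ctr]
  set ρ := (ℝ ∙ nrm e)ᗮ.reflection with hρ
  have hn : ‖x - ctr x₀ a‖ ≠ 0 := norm_ne_zero_iff.2 (sub_ne_zero.2 hx)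
  have h1 : invRefl x₀ e a x - ctr x₀ a = (a ^ 2 / ‖x - ctr x₀ a‖ ^ 2) • ρ (x - ctr x₀ a) := by
    rw [invRefl]; abel_nf; simp [hρ]
  rw [invRefl, h1, norm_smul, Real.norm_eq_abs, abs_of_nonneg (by positivity), LinearIsometryEquiv.norm_map,
    map_smul, ← hρ, show ρ (ρ (x - ctr x₀ a)) = x - ctr x₀ a from Submodule.reflection_reflection _ _, smul_smul]
  have : a ^ 2 / (a ^ 2 / ‖x - ctr x₀ a‖ ^ 2 * ‖x - ctr x₀ a‖) ^ 2 * (a ^ 2 / ‖x - ctr x₀ a‖ ^ 2) = 1 := by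
    field_simp
  rw [this, one_smul, ctr]
  abel

/-- `invRefl` is injective (`a ≠ 0`). [folklore] -/
theorem invRefl_injective (ha : a ≠ 0) : Injective (invRefl x₀ e a) :=
  Function.LeftInverse.injective (g := invRefl x₀ e a) (invRefl_invRefl ha)

/-- `invRefl` is `C^∞` at every point other than the centre. [folklore] -/
theorem contDiffAt_invRefl {x : 𝔼 3} (hx : x ≠ ctr x₀ a) : ContDiffAt ℝ ∞ (invRefl x₀ e a) x := by
  have hn : ‖x - ctr x₀ a‖ ^ 2 ≠ 0 := pow_ne_zero _ (norm_ne_zero_iff.2 (sub_ne_zero.2 hx))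
  have h1 : ContDiffAt ℝ ∞ (fun y : 𝔼 3 ↦ a ^ 2 / ‖y - ctr x₀ a‖ ^ 2) x :=
    contDiffAt_const.div ((contDiffAt_id.sub contDiffAt_const).norm_sq ℝ) hn
  have h2 : ContDiffAt ℝ ∞ (fun y : 𝔼 3 ↦ (ℝ ∙ nrm e)ᗮ.reflection (y - ctr x₀ a)) x :=
    (LinearIsometryEquiv.contDiff _).contDiffAt.comp x (contDiffAt_id.sub contDiffAt_const)
  have hfun : invRefl x₀ e a = fun y ↦ ctr x₀ a + (a ^ 2 / ‖y - ctr x₀ a‖ ^ 2) • (ℝ ∙ nrm e)ᗮ.reflection (y - ctr x₀ a) := rfl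
  rw [hfun]
  exact contDiffAt_const.add (h1.smul h2)

/-- `invRefl` is `C^∞` on the complement of the centre. [folklore] -/
theorem contDiffOn_invRefl : ContDiffOn ℝ ∞ (invRefl x₀ e a) {x | x ≠ ctr x₀ a} := fun _ hx ↦
  (contDiffAt_invRefl hx).contDiffWithinAt

/-- **The differential of an involution is injective** wherever the involution is differentiable
at the point and at its image. [folklore] -/
theorem injective_fderiv_of_involutive {E : Type*} [NormedAddCommGroup E] [NormedSpace ℝ E] {Φ : E → E}
    (hinv : ∀ y, Φ (Φ y) = y) {x : E} (h₁ : DifferentiableAt ℝ Φ x) (h₂ : DifferentiableAt ℝ Φ (Φ x)) :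
    Injective (fderiv ℝ Φ x) := by
  have hcomp : fderiv ℝ (Φ ∘ Φ) x = (fderiv ℝ Φ (Φ x)).comp (fderiv ℝ Φ x) := fderiv_comp x h₂ h₁
  have hid : Φ ∘ Φ = id := funext hinv
  rw [hid, fderiv_id] at hcomp
  refine LeftInverse.injective (g := fderiv ℝ Φ (Φ x)) fun w ↦ ?_
  have := congrArg (fun L : E →L[ℝ] E ↦ L w) hcomp
  simpa using this.symm

/-- The differential of `invRefl` is injective off the centre (`a ≠ 0`). [folklore] -/
theorem injective_fderiv_invRefl (ha : a ≠ 0) {x : 𝔼 3} (hx : x ≠ ctr x₀ a) :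
    Injective (fderiv ℝ (invRefl x₀ e a) x) :=
  injective_fderiv_of_involutive (invRefl_invRefl ha) ((contDiffAt_invRefl hx).differentiableAt (by simp))
    ((contDiffAt_invRefl (invRefl_ne_ctr ha hx)).differentiableAt (by simp))

/-! ### The unbending is an immersion -/

/-- The differential of the unbending shear is injective (for horizontal `e`). [folklore] -/
theorem injective_fderiv_unbend (he2 : e 2 = 0) (hφ : ContDiff ℝ ∞ φ) {w₂ : ℝ} (hw₂ : w₂ < a / 2)
    (hsupp : ∀ w, w₂ ≤ |w| → φ w = 0) (x : 𝔼 3) : Injective (fderiv ℝ (unbend x₀ e a φ) x) := by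
  set g := shearFn x₀ e a φ with hg
  have hgc : ContDiff ℝ ∞ g := contDiff_shearFn hφ hw₂ hsupp
  have hgd : HasFDerivAt g (fderiv ℝ g x) x := ((hgc.differentiable (by simp)) x).hasFDerivAt
  -- `Dg x v₃ = 0` by invariance along `v₃`
  have hDgv : fderiv ℝ g x v₃ = 0 := by
    have hl : HasDerivAt (fun s : ℝ ↦ x + s • v₃) v₃ 0 := by
      simpa using ((hasDerivAt_id (0 : ℝ)).smul_const v₃).const_add x
    have hcomp : HasDerivAt (fun s : ℝ ↦ g (x + s • v₃)) (fderiv ℝ g (x + (0 : ℝ) • v₃) v₃) 0 :=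
      ((hgc.differentiable (by simp)) _).hasFDerivAt.comp_hasDerivAt (0 : ℝ) hl
    simp only [zero_smul, add_zero] at hcomp
    have hconst : (fun s : ℝ ↦ g (x + s • v₃)) = fun _ ↦ g x := funext fun s ↦ shearFn_add_smul he2 x s
    rw [hconst] at hcomp
    exact hcomp.unique (hasDerivAt_const 0 (g x))
  have hfun : unbend x₀ e a φ = fun x ↦ x + g x • v₃ := funext (unbend_eq x₀ e a φ)
  have hd : HasFDerivAt (unbend x₀ e a φ) (ContinuousLinearMap.id ℝ (𝔼 3) + (fderiv ℝ g x).smulRight v₃) x := by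
    rw [hfun]; exact (hasFDerivAt_id x).add (hgd.smul_const v₃)
  rw [hd.fderiv]
  refine (injective_iff_map_eq_zero _).2 fun w hw ↦ ?_
  have hw' : w + (fderiv ℝ g x w) • v₃ = 0 := by simpa [ContinuousLinearMap.smulRight_apply] using hw
  have h2 : fderiv ℝ g x w = 0 := by
    have := congrArg (fderiv ℝ g x) hw'
    rw [map_add, map_smul, hDgv, smul_zero, add_zero, map_zero] at this
    exact this
  rw [h2, zero_smul, add_zero] at hw'
  exact hw'

/-! ### `Ψ` off the centre -/

/-- `Ψ` is `C^∞` at every point other than the centre. [folklore] -/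
theorem contDiffAt_Ψ (hφ : ContDiff ℝ ∞ φ) {w₂ : ℝ} (hw₂ : w₂ < a / 2) (hsupp : ∀ w, w₂ ≤ |w| → φ w = 0)
    {x : 𝔼 3} (hx : x ≠ ctr x₀ a) : ContDiffAt ℝ ∞ (Ψ x₀ e a φ) x :=
  (contDiff_unbend hφ hw₂ hsupp).contDiffAt.comp x (contDiffAt_invRefl hx)

/-- `Ψ` is injective (`a ≠ 0`, `e` horizontal). [folklore] -/
theorem Ψ_injective (he2 : e 2 = 0) (ha : a ≠ 0) : Injective (Ψ x₀ e a φ) :=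
  (unbend_injective he2).comp (invRefl_injective ha)

/-- The differential of `Ψ` is injective off the centre. [folklore] -/
theorem injective_fderiv_Ψ (he2 : e 2 = 0) (ha : a ≠ 0) (hφ : ContDiff ℝ ∞ φ) {w₂ : ℝ} (hw₂ : w₂ < a / 2)
    (hsupp : ∀ w, w₂ ≤ |w| → φ w = 0) {x : 𝔼 3} (hx : x ≠ ctr x₀ a) :
    Injective (fderiv ℝ (Ψ x₀ e a φ) x) := by
  have h1 : DifferentiableAt ℝ (invRefl x₀ e a) x := (contDiffAt_invRefl hx).differentiableAt (by simp)
  have h2 : DifferentiableAt ℝ (unbend x₀ e a φ) (invRefl x₀ e a x) :=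
    ((contDiff_unbend hφ hw₂ hsupp).differentiable (by simp)) _
  have : fderiv ℝ (Ψ x₀ e a φ) x = (fderiv ℝ (unbend x₀ e a φ) (invRefl x₀ e a x)).comp (fderiv ℝ (invRefl x₀ e a) x) :=
    fderiv_comp x h2 h1
  rw [this, ContinuousLinearMap.coe_comp]
  exact (injective_fderiv_unbend he2 hφ hw₂ hsupp _).comp (injective_fderiv_invRefl ha hx)

/-! ### Chart loops through the inverted picture -/

/-- Knots of equal chart loops are equal. [folklore] -/
theorem _root_.Literature.Topology.FourManifolds.IsChartLoop.toKnot_congr' {k k' : ℝ → 𝔼 3} (h : IsChartLoop k)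
    (h' : IsChartLoop k') (e : k = k') : h.toKnot = h'.toKnot := by
  subst e; rfl

/-- An affine image `q + μ • k` (`μ ≠ 0`) of a chart loop is a chart loop. [folklore] -/
theorem _root_.Literature.Topology.FourManifolds.IsChartLoop.affine {k : ℝ → 𝔼 3} (h : IsChartLoop k)
    (q : 𝔼 3) {μ : ℝ} (hμ : μ ≠ 0) : IsChartLoop fun t ↦ q + μ • k t := by
  have hΦ : ContDiff ℝ ∞ fun x : 𝔼 3 ↦ q + μ • x := contDiff_const.add (contDiff_id.const_smul _)
  have hinj : Injective fun x : 𝔼 3 ↦ q + μ • x := fun x y hxy ↦ smul_right_injective _ hμ (add_left_cancel hxy)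
  have hder : ∀ x : 𝔼 3, Injective (fderiv ℝ (fun x : 𝔼 3 ↦ q + μ • x) x) := by
    intro x
    have hd : HasFDerivAt (fun x : 𝔼 3 ↦ q + μ • x) (μ • ContinuousLinearMap.id ℝ (𝔼 3)) x := by
      simpa using ((μ • ContinuousLinearMap.id ℝ (𝔼 3)).hasFDerivAt).const_add q
    rw [hd.fderiv]
    intro v w hvw
    exact smul_right_injective _ hμ (by simpa using hvw)
  exact h.comp_of_injective hΦ hinj hder

/-- **A chart loop avoiding the centre stays a chart loop under `invRefl`, with an isotopic knot**
(`a > 0`, `e` horizontal unit): `invRefl = T ∘ inv3 ∘ ρ₀ ∘ T⁻¹`, two similarities and the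
inversion-with-reflection of `ChartLoops.lean`. [folklore] -/
theorem isChartLoop_invRefl {k : ℝ → 𝔼 3} (h : IsChartLoop k) (he : ‖e‖ = 1) (he2 : e 2 = 0)
    (ha : 0 < a) (hk : ∀ t, k t ≠ ctr x₀ a) :
    IsChartLoop (fun t ↦ invRefl x₀ e a (k t)) ∧
      ∀ h' : IsChartLoop (fun t ↦ invRefl x₀ e a (k t)), h.toKnot.IsIsotopic h'.toKnot := by
  -- step 1: `k₁ = T⁻¹ ∘ k = (2/a) • (k - ctr)`
  have h2a : (2 / a : ℝ) ≠ 0 := by positivity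
  have h₁ : IsChartLoop fun t ↦ -((2 / a) • ctr x₀ a) + (2 / a) • k t := h.affine _ h2a
  have hk₁ : ∀ t, -((2 / a) • ctr x₀ a) + (2 / a) • k t ≠ 0 := fun t h0 ↦ hk t (by
    have : (2 / a) • (k t - ctr x₀ a) = 0 := by rw [smul_sub]; rwa [neg_add_eq_sub] at h0
    exact sub_eq_zero.1 ((smul_eq_zero.1 this).resolve_left h2a))
  have hiso₁ : h.toKnot.IsIsotopic h₁.toKnot := h.isIsotopic_similarity _ (by positivity) h₁
  -- step 2: `k₂ = inv3 ∘ ρ₀ ∘ k₁`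
  obtain ⟨h₂, hiso₂⟩ := h₁.isChartLoop_inv3_reflection hk₁ (nrm_ne_zero he he2)
  -- step 3: `k₃ = ctr + (a/2) • k₂ = invRefl ∘ k`
  have ha2 : (a / 2 : ℝ) ≠ 0 := by positivity
  have h₃ := h₂.affine (ctr x₀ a) ha2
  have hfun : (fun t ↦ ctr x₀ a + (a / 2) • inv3 ((ℝ ∙ nrm e)ᗮ.reflection (-((2 / a) • ctr x₀ a) + (2 / a) • k t))) =
      fun t ↦ invRefl x₀ e a (k t) := by
    funext t
    rw [invRefl_eq x₀ e ha, smul_sub, neg_add_eq_sub]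
  have h' : IsChartLoop fun t ↦ invRefl x₀ e a (k t) := hfun ▸ h₃
  refine ⟨h', fun h'' ↦ ?_⟩
  have hiso₃ : h₂.toKnot.IsIsotopic h₃.toKnot := h₂.isIsotopic_similarity _ (by positivity) h₃
  have heq : h₃.toKnot = h''.toKnot := IsChartLoop.toKnot_congr' h₃ h'' hfun
  have := SphereEmbedding.IsIsotopic.trans_holds (SphereEmbedding.IsIsotopic.trans_holds hiso₁ (hiso₂ h₂)) hiso₃
  rwa [heq] at this

/-- **A chart loop avoiding the centre stays a chart loop under `Ψ`, with an isotopic knot**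
(`a > 0`, `e` horizontal unit, `φ` a `C^∞` cut-off vanishing off `[-w₂, w₂]`, `w₂ < a/2`).
[folklore] -/
theorem isChartLoop_Ψ {k : ℝ → 𝔼 3} (h : IsChartLoop k) (he : ‖e‖ = 1) (he2 : e 2 = 0) (ha : 0 < a)
    (hφ : ContDiff ℝ ∞ φ) {w₂ : ℝ} (hw₂ : w₂ < a / 2) (hsupp : ∀ w, w₂ ≤ |w| → φ w = 0)
    (hk : ∀ t, k t ≠ ctr x₀ a) :
    IsChartLoop (fun t ↦ Ψ x₀ e a φ (k t)) ∧
      ∀ h' : IsChartLoop (fun t ↦ Ψ x₀ e a φ (k t)), h.toKnot.IsIsotopic h'.toKnot := by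
  obtain ⟨h₁, hiso₁⟩ := isChartLoop_invRefl h he he2 ha hk
  have h₂ : IsChartLoop fun t ↦ Ψ x₀ e a φ (k t) :=
    h₁.comp_of_injective (Φ := unbend x₀ e a φ) (contDiff_unbend hφ hw₂ hsupp) (unbend_injective he2)
      (injective_fderiv_unbend he2 hφ hw₂ hsupp)
  refine ⟨h₂, fun h' ↦ ?_⟩
  have hfun : (fun t ↦ invRefl x₀ e a (k t) + shearFn x₀ e a φ (invRefl x₀ e a (k t)) • v₃) =
      fun t ↦ Ψ x₀ e a φ (k t) := funext fun t ↦ (unbend_eq x₀ e a φ _).symm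
  have h₃ : IsChartLoop fun t ↦ invRefl x₀ e a (k t) + shearFn x₀ e a φ (invRefl x₀ e a (k t)) • v₃ := hfun ▸ h₂
  have hiso₂ : h₁.toKnot.IsIsotopic h₃.toKnot :=
    h₁.isIsotopic_shear (contDiff_shearFn hφ hw₂ hsupp) v₃ (shearFn_add_smul he2) h₃
  have heq : h₃.toKnot = h'.toKnot := IsChartLoop.toKnot_congr' h₃ h' hfun
  rw [heq] at hiso₂
  exact SphereEmbedding.IsIsotopic.trans_holds (hiso₁ h₁) hiso₂

end InvertedPicture

end Literature.Topology.FourManifolds
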